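import Mathlib
import HarnessLib
import Summits.ResolutionOfSingularities.ResolutionOfSingularities.Theorems.HomologicalConductorPersistenceKC3JacobianFloorTable
import Summits.ResolutionOfSingularities.ResolutionOfSingularities.Theorems.HomologicalConductorPersistenceFrobeniusDifferent
import Literature.RingTheory.CohomologyAnnihilator.RegularRing
import Literature.RingTheory.CohomologyAnnihilator.Localization

/-!
# K-SD0 branch (ii) SD-K1 — THE VERTEX FLOOR IN THE KERNEL: `b³c² ∈ ca⁴(W₀)` for `W₀ = k[a,b,c]^{μ₆(1,2,3)}`
# over every field (chain W4.4b, seat res-L1-w44b-stub-4 gen 5; CHAIN v13.13 §V13.21.8 «stub-4/037: kernel file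
# b³c² ∈ ca⁴(T₁)»)

[OURS · L1 w44b · K-SD0 stmt-ResolutionOfSingularities-16485 / rung S-2 stmt-…-19970] Nothing here is a statement
of the manuscript under review (Hironaka 2017); AI-written, weaker than expert review.

WHY.  The kill test K-SD0 (crux `StrictDrop`) follows the K-C3 datum tower; its step SD-K1 needs the Newton
polyhedron of `ca(T₁)`, `T₁ = W₀ = k[a,b,c]^{μ₆(1,2,3)}` (res-D-pv-037's `kc3W`): CEILINGS (`a⁶, abc, abc³ ∉ ca`,
res-D-pv-058 / plan-1 / tri-1) and the FLOOR «the sixteen `3 × 3` Jacobian minors of the Hilbert basis, in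
particular the vertex `b³c²`, lie in `ca⁴(T₁)`» — so far a COMPUTATION (plan-1 kit j283499, tri-1 REFEREE-SDK1P:
Noether differents over 20 generic linear normalisations, resting on «`W₀` free over each», numerically checked).
This file proves the vertex membership as a THEOREM, for every field `k`, with no genericity, torus or gradedness
step: over the deformed normalisation `A_u = k[a⁶ + u·abc, b³, c²]` (`W₀` is `A_u`-FREE: `…KC3JacobianFloorBasis`)
the element
  `t_u = 1 ⊗ a⁵b²c + a⁴b ⊗ abc + a²b² ⊗ a³c + a³c ⊗ a²b² + abc ⊗ a⁴b + a⁵b²c ⊗ 1 + u·b³c²·(1 ⊗ 1) ∈ W₀ ⊗_{A_u} W₀`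
(the Reynolds image `(ρ ⊗ ρ)(Δ)` of the Bezoutian `Δ` of `(a⁶ + u·abc, b³, c²)`; for `u = 0` it is the Casimir
element of res-D-pv-037's Frobenius order) is `W₀`-CENTRAL, so `μ(t_u) = 6·a⁵b²c + u·b³c²` lies in the Noether
different `𝔑(W₀/A_u) ⊆ ca⁴(W₀)` (tree `noetherDifferent_le_cohomologyAnnihilatorOfDegree_of_projective`, `ca⁴(A_u) = A_u`
by Hilbert's syzygy theorem); subtracting `u = 0` from `u = 1` gives `b³c² ∈ ca⁴(W₀)`.  (`6·μ(t_u)` is the Jacobian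
`J(a⁶ + u·abc, b³, c²) = 36·a⁵b²c + 6u·b³c²`: the different of the invariant ring over an h.s.o.p. is generated by
its Jacobian — Benson, *Polynomial invariants of finite groups*, §3 — which is the mechanism behind the chain's
«F16 = Jacobian minors» observation; nothing of it is used as a premise here.)

RESULTS.
* shortcut instances `kc3W.tensor…Au` (Mathlib's own tensor-product instances, for typeclass performance only);
* `central_m1 … central_m4`, **`central`** — `(b ⊗ 1)·t_u = (1 ⊗ b)·t_u` for all `b ∈ W₀` (table + `module`, then
  `adjoin_box_eq_top`); `lmul'_t` — `μ(t_u) = 6·a⁵b²c + u·b³c²`;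
* `jacobian_mem_noetherDifferent`, `cohomologyAnnihilatorOfDegree_four_kc3Au_eq_top`,
  **`jacobian_mem_cohomologyAnnihilatorOfDegree_four`** — `6·a⁵b²c + u·b³c² ∈ ca⁴(W₀)` for every `u ∈ k`;
* **`b3c2_mem_cohomologyAnnihilatorOfDegree_four`**, `b3c2_mem_cohomologyAnnihilator`,
  `X1_pow_three_mul_X2_sq_mem_cohomologyAnnihilatorOfDegree_four`, `a5b2c_mem_cohomologyAnnihilatorOfDegree_four`.

References: S. B. Iyengar, R. Takahashi, IMRN 2016, arXiv:1404.1476, §3 (noether different) [`IyengarTakahashi2014`];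
D. J. Benson, *Polynomial invariants of finite groups* (CUP 1993), §3.  Mechanism only; no premise is cited.
-/

noncomputable section

-- single-problem summit: the doubled namespace component `ResolutionOfSingularities` is forced
set_option linter.dupNamespace false

open MvPolynomial

universe u

namespace Summit.ResolutionOfSingularities.ResolutionOfSingularities.Theorems.HomologicalConductor.KC3JacobianFloor

open Summit.ResolutionOfSingularities.ResolutionOfSingularities.Theorems.HomologicalConductor.KC3Witness
  (e e_apply_zero e_apply_one e_apply_two e_add e_zero e_le_iff e_sub)
open Summit.ResolutionOfSingularities.ResolutionOfSingularities.Theorems.HomologicalConductor.KC3FrobeniusOrder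
open Summit.ResolutionOfSingularities.ResolutionOfSingularities.Theorems.HomologicalConductor.KC3XbLattice (monomial_e)

variable {k : Type u} [Field k] (u : k)

/-! ## The central element `t_u = Σᵢ mᵢ ⊗ m₅₋ᵢ + u·b³c²·(1 ⊗ 1)` of `W₀ ⊗_{A_u} W₀` -/

section Central

open scoped TensorProduct

/-! Shortcut instances — typeclass PERFORMANCE only: each is literally Mathlib's instance, declared here so
that instance search for `W₀ ⊗_{A_u} W₀` does not wander into `Subalgebra.instSMulSubtypeMem` (the
`k[a,b,c]`-actions every subalgebra inherits), which exhausts the synthesis budget. -/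

/-- `A_u` acts on `W₀ ⊗_{A_u} W₀` (Mathlib's `TensorProduct.leftHasSMul`). [OURS · bookkeeping] -/
instance kc3W.tensorSMulAu : SMul ↥(kc3Au u) (↥(kc3W k) ⊗[↥(kc3Au u)] ↥(kc3W k)) := TensorProduct.leftHasSMul

/-- `W₀ ⊗_{A_u} W₀` is an additive group (Mathlib's `TensorProduct.addCommGroup`). [OURS · bookkeeping] -/
instance kc3W.tensorAddCommGroupAu : AddCommGroup (↥(kc3W k) ⊗[↥(kc3Au u)] ↥(kc3W k)) :=
  TensorProduct.addCommGroup

/-- `W₀ ⊗_{A_u} W₀` is an `A_u`-module (Mathlib's `TensorProduct.leftModule`). [OURS · bookkeeping] -/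
instance kc3W.tensorModuleAu : Module ↥(kc3Au u) (↥(kc3W k) ⊗[↥(kc3Au u)] ↥(kc3W k)) :=
  TensorProduct.leftModule

/-- `W₀ ⊗_{A_u} W₀` is a commutative ring (Mathlib's `Algebra.TensorProduct.instCommRing`). [OURS · bookkeeping] -/
instance kc3W.tensorCommRingAu : CommRing (↥(kc3W k) ⊗[↥(kc3Au u)] ↥(kc3W k)) :=
  Algebra.TensorProduct.instCommRing

/-- `W₀ ⊗_{A_u} W₀` is an `A_u`-algebra (Mathlib's `Algebra.TensorProduct.leftAlgebra`). [OURS · bookkeeping] -/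
instance kc3W.tensorAlgebraAu : Algebra ↥(kc3Au u) (↥(kc3W k) ⊗[↥(kc3Au u)] ↥(kc3W k)) :=
  Algebra.TensorProduct.leftAlgebra

set_option maxHeartbeats 400000 in
/-- Centrality of `t_u` against `m1`. [OURS · L1 w44b] -/
theorem central_m1 :
    (boxMonomial k 1 ⊗ₜ[↥(kc3Au u)] (1 : ↥(kc3W k))) *
        ((1 : ↥(kc3W k)) ⊗ₜ[↥(kc3Au u)] boxMonomial k 5 + boxMonomial k 1 ⊗ₜ boxMonomial k 4 +
          boxMonomial k 2 ⊗ₜ boxMonomial k 3 + boxMonomial k 3 ⊗ₜ boxMonomial k 2 +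
          boxMonomial k 4 ⊗ₜ boxMonomial k 1 + boxMonomial k 5 ⊗ₜ 1 +
          (algebraMap k _ u * θuA u (X 1) * θuA u (X 2)) • ((1 : ↥(kc3W k)) ⊗ₜ[↥(kc3Au u)] (1 : ↥(kc3W k)))) =
      ((1 : ↥(kc3W k)) ⊗ₜ[↥(kc3Au u)] boxMonomial k 1) *
        ((1 : ↥(kc3W k)) ⊗ₜ[↥(kc3Au u)] boxMonomial k 5 + boxMonomial k 1 ⊗ₜ boxMonomial k 4 +
          boxMonomial k 2 ⊗ₜ boxMonomial k 3 + boxMonomial k 3 ⊗ₜ boxMonomial k 2 +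
          boxMonomial k 4 ⊗ₜ boxMonomial k 1 + boxMonomial k 5 ⊗ₜ 1 +
          (algebraMap k _ u * θuA u (X 1) * θuA u (X 2)) • ((1 : ↥(kc3W k)) ⊗ₜ[↥(kc3Au u)] (1 : ↥(kc3W k)))) := by
  simp only [mul_add, mul_smul_comm, Algebra.TensorProduct.tmul_mul_tmul, one_mul, mul_one,
    m1_mul_m1 u, m1_mul_m2 u, m1_mul_m3 u, m1_mul_m4, m1_mul_m5 u, boxMonomial_zero,
    TensorProduct.sub_tmul, TensorProduct.tmul_sub, ← TensorProduct.smul_tmul', TensorProduct.tmul_smul]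
  module

/-- Centrality of `t_u` against `m2`. [OURS · L1 w44b] -/
theorem central_m2 :
    (boxMonomial k 2 ⊗ₜ[↥(kc3Au u)] (1 : ↥(kc3W k))) *
        ((1 : ↥(kc3W k)) ⊗ₜ[↥(kc3Au u)] boxMonomial k 5 + boxMonomial k 1 ⊗ₜ boxMonomial k 4 +
          boxMonomial k 2 ⊗ₜ boxMonomial k 3 + boxMonomial k 3 ⊗ₜ boxMonomial k 2 +
          boxMonomial k 4 ⊗ₜ boxMonomial k 1 + boxMonomial k 5 ⊗ₜ 1 +
          (algebraMap k _ u * θuA u (X 1) * θuA u (X 2)) • ((1 : ↥(kc3W k)) ⊗ₜ[↥(kc3Au u)] (1 : ↥(kc3W k)))) =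
      ((1 : ↥(kc3W k)) ⊗ₜ[↥(kc3Au u)] boxMonomial k 2) *
        ((1 : ↥(kc3W k)) ⊗ₜ[↥(kc3Au u)] boxMonomial k 5 + boxMonomial k 1 ⊗ₜ boxMonomial k 4 +
          boxMonomial k 2 ⊗ₜ boxMonomial k 3 + boxMonomial k 3 ⊗ₜ boxMonomial k 2 +
          boxMonomial k 4 ⊗ₜ boxMonomial k 1 + boxMonomial k 5 ⊗ₜ 1 +
          (algebraMap k _ u * θuA u (X 1) * θuA u (X 2)) • ((1 : ↥(kc3W k)) ⊗ₜ[↥(kc3Au u)] (1 : ↥(kc3W k)))) := by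
  simp only [mul_add, mul_smul_comm, Algebra.TensorProduct.tmul_mul_tmul, one_mul, mul_one,
    m2_mul_m1 u, m2_mul_m2 u, m2_mul_m3, m2_mul_m4 u, m2_mul_m5 u, boxMonomial_zero,
    TensorProduct.sub_tmul, TensorProduct.tmul_sub, ← TensorProduct.smul_tmul', TensorProduct.tmul_smul]
  module

set_option maxHeartbeats 400000 in
/-- Centrality of `t_u` against `m3`. [OURS · L1 w44b] -/
theorem central_m3 :
    (boxMonomial k 3 ⊗ₜ[↥(kc3Au u)] (1 : ↥(kc3W k))) *
        ((1 : ↥(kc3W k)) ⊗ₜ[↥(kc3Au u)] boxMonomial k 5 + boxMonomial k 1 ⊗ₜ boxMonomial k 4 +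
          boxMonomial k 2 ⊗ₜ boxMonomial k 3 + boxMonomial k 3 ⊗ₜ boxMonomial k 2 +
          boxMonomial k 4 ⊗ₜ boxMonomial k 1 + boxMonomial k 5 ⊗ₜ 1 +
          (algebraMap k _ u * θuA u (X 1) * θuA u (X 2)) • ((1 : ↥(kc3W k)) ⊗ₜ[↥(kc3Au u)] (1 : ↥(kc3W k)))) =
      ((1 : ↥(kc3W k)) ⊗ₜ[↥(kc3Au u)] boxMonomial k 3) *
        ((1 : ↥(kc3W k)) ⊗ₜ[↥(kc3Au u)] boxMonomial k 5 + boxMonomial k 1 ⊗ₜ boxMonomial k 4 +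
          boxMonomial k 2 ⊗ₜ boxMonomial k 3 + boxMonomial k 3 ⊗ₜ boxMonomial k 2 +
          boxMonomial k 4 ⊗ₜ boxMonomial k 1 + boxMonomial k 5 ⊗ₜ 1 +
          (algebraMap k _ u * θuA u (X 1) * θuA u (X 2)) • ((1 : ↥(kc3W k)) ⊗ₜ[↥(kc3Au u)] (1 : ↥(kc3W k)))) := by
  simp only [mul_add, mul_smul_comm, Algebra.TensorProduct.tmul_mul_tmul, one_mul, mul_one,
    m3_mul_m1 u, m3_mul_m2, m3_mul_m3 u, m3_mul_m4 u, m3_mul_m5 u, boxMonomial_zero,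
    TensorProduct.sub_tmul, TensorProduct.tmul_sub, ← TensorProduct.smul_tmul', TensorProduct.tmul_smul]
  module

/-- Centrality of `t_u` against `m4`. [OURS · L1 w44b] -/
theorem central_m4 :
    (boxMonomial k 4 ⊗ₜ[↥(kc3Au u)] (1 : ↥(kc3W k))) *
        ((1 : ↥(kc3W k)) ⊗ₜ[↥(kc3Au u)] boxMonomial k 5 + boxMonomial k 1 ⊗ₜ boxMonomial k 4 +
          boxMonomial k 2 ⊗ₜ boxMonomial k 3 + boxMonomial k 3 ⊗ₜ boxMonomial k 2 +
          boxMonomial k 4 ⊗ₜ boxMonomial k 1 + boxMonomial k 5 ⊗ₜ 1 +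
          (algebraMap k _ u * θuA u (X 1) * θuA u (X 2)) • ((1 : ↥(kc3W k)) ⊗ₜ[↥(kc3Au u)] (1 : ↥(kc3W k)))) =
      ((1 : ↥(kc3W k)) ⊗ₜ[↥(kc3Au u)] boxMonomial k 4) *
        ((1 : ↥(kc3W k)) ⊗ₜ[↥(kc3Au u)] boxMonomial k 5 + boxMonomial k 1 ⊗ₜ boxMonomial k 4 +
          boxMonomial k 2 ⊗ₜ boxMonomial k 3 + boxMonomial k 3 ⊗ₜ boxMonomial k 2 +
          boxMonomial k 4 ⊗ₜ boxMonomial k 1 + boxMonomial k 5 ⊗ₜ 1 +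
          (algebraMap k _ u * θuA u (X 1) * θuA u (X 2)) • ((1 : ↥(kc3W k)) ⊗ₜ[↥(kc3Au u)] (1 : ↥(kc3W k)))) := by
  simp only [mul_add, mul_smul_comm, Algebra.TensorProduct.tmul_mul_tmul, one_mul, mul_one,
    m4_mul_m1, m4_mul_m2 u, m4_mul_m3 u, m4_mul_m4 u, m4_mul_m5 u, boxMonomial_zero,
    TensorProduct.sub_tmul, TensorProduct.tmul_sub, ← TensorProduct.smul_tmul', TensorProduct.tmul_smul]
  module

/-- **`t_u` is `W₀`-central**: `(b ⊗ 1)·t_u = (1 ⊗ b)·t_u` for every `b ∈ W₀` (generators + `adjoin_box_eq_top`).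
[OURS · L1 w44b] -/
theorem central (b : ↥(kc3W k)) :
    (b ⊗ₜ[↥(kc3Au u)] (1 : ↥(kc3W k))) *
        ((1 : ↥(kc3W k)) ⊗ₜ[↥(kc3Au u)] boxMonomial k 5 + boxMonomial k 1 ⊗ₜ boxMonomial k 4 +
          boxMonomial k 2 ⊗ₜ boxMonomial k 3 + boxMonomial k 3 ⊗ₜ boxMonomial k 2 +
          boxMonomial k 4 ⊗ₜ boxMonomial k 1 + boxMonomial k 5 ⊗ₜ 1 +
          (algebraMap k _ u * θuA u (X 1) * θuA u (X 2)) • ((1 : ↥(kc3W k)) ⊗ₜ[↥(kc3Au u)] (1 : ↥(kc3W k)))) =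
      ((1 : ↥(kc3W k)) ⊗ₜ[↥(kc3Au u)] b) *
        ((1 : ↥(kc3W k)) ⊗ₜ[↥(kc3Au u)] boxMonomial k 5 + boxMonomial k 1 ⊗ₜ boxMonomial k 4 +
          boxMonomial k 2 ⊗ₜ boxMonomial k 3 + boxMonomial k 3 ⊗ₜ boxMonomial k 2 +
          boxMonomial k 4 ⊗ₜ boxMonomial k 1 + boxMonomial k 5 ⊗ₜ 1 +
          (algebraMap k _ u * θuA u (X 1) * θuA u (X 2)) • ((1 : ↥(kc3W k)) ⊗ₜ[↥(kc3Au u)] (1 : ↥(kc3W k)))) := by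
  set t := ((1 : ↥(kc3W k)) ⊗ₜ[↥(kc3Au u)] boxMonomial k 5 + boxMonomial k 1 ⊗ₜ boxMonomial k 4 +
          boxMonomial k 2 ⊗ₜ boxMonomial k 3 + boxMonomial k 3 ⊗ₜ boxMonomial k 2 +
          boxMonomial k 4 ⊗ₜ boxMonomial k 1 + boxMonomial k 5 ⊗ₜ 1 +
          (algebraMap k _ u * θuA u (X 1) * θuA u (X 2)) • ((1 : ↥(kc3W k)) ⊗ₜ[↥(kc3Au u)] (1 : ↥(kc3W k)))) with ht
  have hb : b ∈ Algebra.adjoin ↥(kc3Au u)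
      ({boxMonomial k 1, boxMonomial k 2, boxMonomial k 3, boxMonomial k 4} : Set ↥(kc3W k)) := by
    rw [adjoin_box_eq_top]; exact Algebra.mem_top
  refine Algebra.adjoin_induction (p := fun b _ =>
    (b ⊗ₜ[↥(kc3Au u)] (1 : ↥(kc3W k))) * t = ((1 : ↥(kc3W k)) ⊗ₜ[↥(kc3Au u)] b) * t) ?_ ?_ ?_ ?_ hb
  · intro x hx
    simp only [Set.mem_insert_iff, Set.mem_singleton_iff] at hx
    rcases hx with rfl | rfl | rfl | rfl
    · exact central_m1 u
    · exact central_m2 u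
    · exact central_m3 u
    · exact central_m4 u
  · intro p
    rw [Algebra.algebraMap_eq_smul_one, TensorProduct.smul_tmul]
  · intro x y _ _ hx hy
    rw [TensorProduct.add_tmul, TensorProduct.tmul_add, add_mul, add_mul, hx, hy]
  · intro x y _ _ hx hy
    have ex : (x * y) ⊗ₜ[↥(kc3Au u)] (1 : ↥(kc3W k)) = (x ⊗ₜ[↥(kc3Au u)] (1 : ↥(kc3W k))) * (y ⊗ₜ 1) := by
      rw [Algebra.TensorProduct.tmul_mul_tmul, mul_one]
    have ey : (1 : ↥(kc3W k)) ⊗ₜ[↥(kc3Au u)] (x * y) = ((1 : ↥(kc3W k)) ⊗ₜ[↥(kc3Au u)] y) * (1 ⊗ₜ x) := by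
      rw [Algebra.TensorProduct.tmul_mul_tmul, mul_one, mul_comm y x]
    rw [ex, ey, mul_assoc, hy, ← mul_assoc, mul_comm (x ⊗ₜ[↥(kc3Au u)] (1 : ↥(kc3W k))), mul_assoc, hx,
      ← mul_assoc]

/-- **`μ(t_u) = 6·a⁵b²c + u·b³c²`.** [OURS · L1 w44b] -/
theorem lmul'_t :
    Algebra.TensorProduct.lmul' (S := ↥(kc3W k)) ↥(kc3Au u)
        ((1 : ↥(kc3W k)) ⊗ₜ[↥(kc3Au u)] boxMonomial k 5 + boxMonomial k 1 ⊗ₜ boxMonomial k 4 +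
          boxMonomial k 2 ⊗ₜ boxMonomial k 3 + boxMonomial k 3 ⊗ₜ boxMonomial k 2 +
          boxMonomial k 4 ⊗ₜ boxMonomial k 1 + boxMonomial k 5 ⊗ₜ 1 +
          (algebraMap k _ u * θuA u (X 1) * θuA u (X 2)) • ((1 : ↥(kc3W k)) ⊗ₜ[↥(kc3Au u)] (1 : ↥(kc3W k)))) =
      ⟨monomial (e 5 2 1) 6 + monomial (e 0 3 2) u, add_mem (monomial_mem_kc3W (by simp [wt]) _)
        (monomial_mem_kc3W (by simp [wt]) _)⟩ := by
  simp only [map_add, map_smul, Algebra.TensorProduct.lmul'_apply_tmul, one_mul, mul_one, m1_mul_m4, m2_mul_m3,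
    m3_mul_m2, m4_mul_m1]
  apply Subtype.ext
  simp only [Subalgebra.coe_add, coe_smul_kc3Au, Subalgebra.coe_mul, coe_θuA, θu_X_one,
    θu_X_two, coe_algebraMap_k, Subalgebra.coe_one, coe_boxMonomial, box_five, monomial_e]
  simp only [map_one, one_mul, mul_one, pow_zero, map_ofNat]
  ring

end Central


/-! ## The different floor: `6·a⁵b²c + u·b³c² ∈ 𝔑(W₀/A_u) ⊆ ca⁴(W₀)`, hence `b³c² ∈ ca⁴(W₀)` -/

section Floor

open scoped TensorProduct
open Literature.RingTheory.CohomologyAnnihilator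
open Summit.ResolutionOfSingularities.ResolutionOfSingularities.Theorems.HomologicalConductor.PersistenceFrobeniusDifferent

/-- **`6·a⁵b²c + u·b³c² ∈ 𝔑(W₀/A_u)`** — the image of the central element `t_u` (= `(ρ ⊗ ρ)` of the Bezoutian
of `(a⁶ + u·abc, b³, c²)`; its value is `J(a⁶ + u·abc, b³, c²)/6`). [OURS · L1 w44b] -/
theorem jacobian_mem_noetherDifferent :
    (⟨monomial (e 5 2 1) 6 + monomial (e 0 3 2) u, add_mem (monomial_mem_kc3W (by simp [wt]) _)
        (monomial_mem_kc3W (by simp [wt]) _)⟩ : ↥(kc3W k)) ∈ noetherDifferent ↥(kc3Au u) ↥(kc3W k) :=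
  mem_noetherDifferent_iff.mpr ⟨((1 : ↥(kc3W k)) ⊗ₜ[↥(kc3Au u)] boxMonomial k 5 + boxMonomial k 1 ⊗ₜ boxMonomial k 4 +
          boxMonomial k 2 ⊗ₜ boxMonomial k 3 + boxMonomial k 3 ⊗ₜ boxMonomial k 2 +
          boxMonomial k 4 ⊗ₜ boxMonomial k 1 + boxMonomial k 5 ⊗ₜ 1 +
          (algebraMap k _ u * θuA u (X 1) * θuA u (X 2)) • ((1 : ↥(kc3W k)) ⊗ₜ[↥(kc3Au u)] (1 : ↥(kc3W k)))), central u, lmul'_t u⟩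

/-- `ca⁴(A_u) = A_u` (Hilbert's syzygy theorem for `k[A,B,C]`, transported along `kc3θuEquiv`). [folklore] -/
theorem cohomologyAnnihilatorOfDegree_four_kc3Au_eq_top :
    cohomologyAnnihilatorOfDegree ↥(kc3Au u) 4 = ⊤ := by
  have h := map_ringEquiv_cohomologyAnnihilatorOfDegree (kc3θuEquiv u).toRingEquiv (3 + 1)
  rw [cohomologyAnnihilatorOfDegree_mvPolynomial_eq_top k 3, Ideal.map_top] at h
  exact h.symm

/-- **The different floor over `A_u`**: `6·a⁵b²c + u·b³c² ∈ ca⁴(W₀)` for every `u ∈ k` (`W₀` is free over the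
noetherian `A_u` with `ca⁴(A_u) = A_u`; tree `noetherDifferent_le_cohomologyAnnihilatorOfDegree_of_projective`,
res-L1-w44b-idea-2 p532326). [OURS · L1 w44b] -/
theorem jacobian_mem_cohomologyAnnihilatorOfDegree_four :
    (⟨monomial (e 5 2 1) 6 + monomial (e 0 3 2) u, add_mem (monomial_mem_kc3W (by simp [wt]) _)
        (monomial_mem_kc3W (by simp [wt]) _)⟩ : ↥(kc3W k)) ∈ cohomologyAnnihilatorOfDegree ↥(kc3W k) 4 :=
  noetherDifferent_le_cohomologyAnnihilatorOfDegree_of_projective (d := 3)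
    (cohomologyAnnihilatorOfDegree_four_kc3Au_eq_top u) (jacobian_mem_noetherDifferent u)

end Floor

section Vertex

open Literature.RingTheory.CohomologyAnnihilator

/-- **`6·a⁵b²c ∈ ca⁴(W₀)`** (the case `u = 0`: the different of the monomial normalisation `P₀ = k[a⁶,b³,c²]`).
[OURS · L1 w44b] -/
theorem a5b2c_mem_cohomologyAnnihilatorOfDegree_four :
    (⟨monomial (e 5 2 1) 6, monomial_mem_kc3W (by simp [wt]) _⟩ : ↥(kc3W k)) ∈
      cohomologyAnnihilatorOfDegree ↥(kc3W k) 4 := by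
  have h := jacobian_mem_cohomologyAnnihilatorOfDegree_four (k := k) 0
  convert h using 1
  apply Subtype.ext
  change monomial (e 5 2 1) (6 : k) = monomial (e 5 2 1) 6 + monomial (e 0 3 2) 0
  rw [monomial_zero, add_zero]

/-- **THE SD-K1 VERTEX FLOOR: `b³c² ∈ ca⁴(W₀)`** for `W₀ = k[a,b,c]^{μ₆(1,2,3)}` over EVERY field `k` — the
difference of the different floors over `A₁ = k[a⁶ + abc, b³, c²]` and `A₀ = k[a⁶, b³, c²]`; no torus, gradedness
or generic-normalisation step, and no hypothesis on the characteristic. [OURS · L1 w44b] -/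
theorem b3c2_mem_cohomologyAnnihilatorOfDegree_four :
    (⟨monomial (e 0 3 2) 1, monomial_mem_kc3W (by simp [wt]) _⟩ : ↥(kc3W k)) ∈
      cohomologyAnnihilatorOfDegree ↥(kc3W k) 4 := by
  have h := Ideal.sub_mem _ (jacobian_mem_cohomologyAnnihilatorOfDegree_four (k := k) 1)
    (jacobian_mem_cohomologyAnnihilatorOfDegree_four (k := k) 0)
  convert h using 1
  apply Subtype.ext
  change monomial (e 0 3 2) (1 : k) =
    (monomial (e 5 2 1) 6 + monomial (e 0 3 2) 1) - (monomial (e 5 2 1) 6 + monomial (e 0 3 2) 0)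
  rw [monomial_zero, add_zero, add_sub_cancel_left]

/-- `b³c² ∈ ca(W₀)` (the route's `ca = ⋃ₙ caⁿ`). [OURS · L1 w44b] -/
theorem b3c2_mem_cohomologyAnnihilator :
    (⟨monomial (e 0 3 2) 1, monomial_mem_kc3W (by simp [wt]) _⟩ : ↥(kc3W k)) ∈ cohomologyAnnihilator ↥(kc3W k) :=
  cohomologyAnnihilatorOfDegree_le 4 b3c2_mem_cohomologyAnnihilatorOfDegree_four

/-- The same with `b³c²` spelled `X 1 ^ 3 * X 2 ^ 2`. [OURS · L1 w44b] -/
theorem X1_pow_three_mul_X2_sq_mem_cohomologyAnnihilatorOfDegree_four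
    (h : (X 1 ^ 3 * X 2 ^ 2 : MvPolynomial (Fin 3) k) ∈ kc3W k) :
    (⟨X 1 ^ 3 * X 2 ^ 2, h⟩ : ↥(kc3W k)) ∈ cohomologyAnnihilatorOfDegree ↥(kc3W k) 4 := by
  convert b3c2_mem_cohomologyAnnihilatorOfDegree_four (k := k) using 1
  apply Subtype.ext
  change (X 1 ^ 3 * X 2 ^ 2 : MvPolynomial (Fin 3) k) = monomial (e 0 3 2) 1
  rw [monomial_e, map_one, one_mul, pow_zero, one_mul]

/-- **`b³c²/1 ∈ ca⁴(T)` for every localisation `T` of `W₀`** (e.g. K-C3's `T₁ = loc_O W`, the local ring at the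
vertex): tree Lemma 2.10(1) `map_cohomologyAnnihilatorOfDegree_le_of_isLocalization`. [OURS · L1 w44b] -/
theorem b3c2_mem_cohomologyAnnihilatorOfDegree_four_of_isLocalization (M : Submonoid ↥(kc3W k)) (T : Type u)
    [CommRing T] [Algebra ↥(kc3W k) T] [IsLocalization M T] :
    algebraMap ↥(kc3W k) T ⟨monomial (e 0 3 2) 1, monomial_mem_kc3W (by simp [wt]) _⟩ ∈
      cohomologyAnnihilatorOfDegree T 4 :=
  map_cohomologyAnnihilatorOfDegree_le_of_isLocalization M T 4
    (Ideal.mem_map_of_mem _ b3c2_mem_cohomologyAnnihilatorOfDegree_four)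

end Vertex

end Summit.ResolutionOfSingularities.ResolutionOfSingularities.Theorems.HomologicalConductor.KC3JacobianFloor

end
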